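import Mathlib.RingTheory.Trace.Basic
import Mathlib.LinearAlgebra.Semisimple
import Mathlib.LinearAlgebra.StdBasis
import Mathlib.FieldTheory.PrimitiveElement
import Mathlib.FieldTheory.Galois.Basic
import Literature.NumberTheory.ComplexMultiplication.CMAlgebraReflexField
import Literature.RepresentationTheory.Semisimple.EquivOfCharacter
import HarnessLib

/-!
# The `E ⊗_ℚ k`-module with traces `Σ_{φ∈Φ} φ(a)` exists iff `k ⊇ E*` (Milne, *Complex Multiplication*,
# Ch. I §1 «The reflex norm», Prop. 1.21, Cor. 1.22)

Layer `Literature/NumberTheory/ComplexMultiplication`.  Definitions with bodies (`piEnd`, `orbitField`,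
`toOrbitField`, `orbitFieldAct`, `embOfAlgHom`, `conjugatesOver`, `orbitRep`, `orbitReps`, `traceModule`,
`traceModuleAct`, `baseChangeAct`), theorems; no named fact (D-0026, net debt 0).

THE PRINT.  J. S. Milne, *Complex Multiplication* (course notes) [MilneCM2006], Ch. I §1, «The reflex norm», p. 15 of
the version of July 14, 2020 (open text, read 2026-08-21 as `paper:url-8ccc30e4daab` p0015–p0016), verbatim:

> «Let `k` be a number field.  To give a finitely generated `E ⊗_ℚ k`-module amounts to giving a finite-dimensional
> `ℚ`-vector space together with commuting `ℚ`-linear actions of `E` and `k` (i.e., an `(E, k)`-bimodule over `ℚ`),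
> or a finite-dimensional `k`-vector space `V` together with a `k`-linear action of `E` (i.e., an action of `E` on
> `V` such that each `a ∈ E` acts by `k`-linear endomorphisms).
> PROPOSITION 1.21 Let `(E, Φ)` be a CM-pair, and let `k` be a subfield of `ℚ̄`.  There exists a finitely generated
> `E ⊗_ℚ k`-module `V` such that `Tr_k(a|V) = Σ_{φ∈Φ} φ(a)`, all `a ∈ E`, (5) if and only if `k ⊇ E*`, in which
> case `V` is uniquely determined up to an `E ⊗_ℚ k`-isomorphism.
> PROOF. If `a` acts `k`-linearly on `V`, then `Tr_k(a|V) ∈ k`, and so, if there exists a `k`-linear action of `E`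
> satisfying (5) on a `k`-vector space `V`, then certainly `k ⊇ E*`.  For the converse, we initially assume that
> `k` contains all the conjugates of `E`.  There is then a canonical isomorphism `e ⊗ a ↦ (φ(e)a)_φ : E ⊗_ℚ k →
> ∏_{φ : E → k} k_φ`, and so any `E ⊗_ℚ k`-module `V` is of the form `⊕_φ m_φ k_φ` for unique nonnegative integers
> `m_φ`, where `k_φ` denotes a one-dimensional `k`-vector space on which `e ∈ E` acts as `φ(e)`.  Thus, up to
> isomorphism, there exists exactly one `E ⊗_ℚ k`-module satisfying (5), namely, `⊕_{φ∈Φ} k_φ`.  For a general `k`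
> containing `E*`, we use the following statement: [Galois descent for a finite Galois `Ω/k`, AG 16.14].  Let `Ω`
> be any finite Galois extension of `k` containing all conjugates of `E`.  Consider the `E ⊗_ℚ Ω`-module
> `⊕_{φ∈Φ} Ω_φ` […].  Because `Φ` is stable under `Γ`, we can define a semilinear action of `Γ` on `⊕_{φ∈Φ} Ω_φ`
> […] Any `E ⊗_ℚ k`-module satisfying (5) becomes isomorphic to `⊕_{φ∈Φ} Ω_φ` over `Ω`, and so this shows that,
> up to isomorphism, there exists exactly one such `E ⊗_ℚ k`-module.
> COROLLARY 1.22 The reflex field `E*` is the smallest subfield of `ℚ̄` such that there exists an `E ⊗_ℚ E*`-module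
> `V` with `V ⊗_{E*} ℚ̄ ≃ ⊕_{φ∈Φ} ℚ̄_φ` (as an `E ⊗_ℚ ℚ̄`-module), (6) where `ℚ̄_φ` is a one-dimensional `ℚ̄`-vector
> space on which `E` acts through `φ`.  PROOF. Restatement of the proposition.»

SETTING (the tree's vocabulary).  `(E, Φ)` is a CM-pair on the Gao–Ullmo carrier: `E` a commutative `ℚ`-algebra,
finite over `ℚ`, `Emb E = (E →ₐ[ℚ] ℂ)`, `Φ : CMTypeOn E` (`GaoUllmo2025/CMHodgeModel`); `E* = reflexFieldOn Φ ⊂ ℂ`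
(`CMAlgebraReflexField`, Def. 1.17), for a number field `E* = traceField Φ`.  `ℚ̄` is read inside `ℂ`, the field
`k` is an `IntermediateField ℚ ℂ` — ANY subfield of `ℂ` (the print: a subfield of `ℚ̄`) —, and `Gal(ℚ̄/k)` is
replaced by `Aut(ℂ/k) = k.fixingSubgroup ≤ (ℂ ≃ₐ[ℚ] ℂ)` acting on `Emb E` by composition (`autEmbAction`).  An
«`E ⊗_ℚ k`-module» is taken in the second printed form: a finite-dimensional `k`-vector space `V` with a ring
homomorphism `ρ : E →+* Module.End k V` («each `a ∈ E` acts by `k`-linear endomorphisms»); the identity (5) reads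
`algebraMap k ℂ (LinearMap.trace k V (ρ a)) = cmTraceOn Φ a` (`cmTraceOn Φ a = Σ_{φ∈Φ} φ a`), and an
«`E ⊗_ℚ k`-isomorphism» is a `k`-linear equivalence commuting with the two actions.

WHAT IS PROVED.
* §2 **«only if»** `reflexFieldOn_le_of_trace_eq`: as printed, the traces lie in `k`.
* §1, §3 **«if» for a number field `k ⊇ E*`**, by writing down the descended module instead of invoking Galois
  descent (DEVIATION from the printed proof, same object): for `φ ∈ Emb E` let `k·φ(E) = orbitField k φ ⊂ ℂ` with
  `E` acting through `φ` (`orbitFieldAct`); its trace is the field trace, `Tr_k(a | k·φ(E)) = Σ_σ σ(φ(a))` over the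
  `k`-embeddings `σ : k·φ(E) → ℂ` (Mathlib `trace_eq_sum_embeddings`), i.e. the sum of `ψ(a)` over the
  `k`-conjugates `ψ = σ ∘ φ` of `φ` (`conjugatesOver`, `algebraMap_trace_orbitFieldAct`), and for `k` finite over
  `ℚ` these are exactly the `Aut(ℂ/k)`-orbit of `φ` (`coe_conjugatesOver`, by extending `σ` to an automorphism of
  `ℂ`, the tree's `exists_ringEquiv_apply_eq_algHom`).  «Because `Φ` is stable under `Γ`» (Prop. 1.16,
  `forall_mem_reflexFieldOn_apply_eq_iff`, as `smul_mem_of_reflexFieldOn_le`) `Φ` is a disjoint union of orbits, and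
  **`V_Φ := ⊕_O k·φ_O(E)`** over the orbits `O ⊆ Φ` with chosen representatives `φ_O` (`traceModule`,
  `traceModuleAct`) has `Tr_k(a|V_Φ) = Σ_{φ∈Φ} φ(a)` (`algebraMap_trace_traceModuleAct`; block-diagonal trace
  `trace_piEnd`, then `Finset.sum_fiberwise`) and `dim_k V_Φ = |Φ|` (`finrank_traceModule`).  (When `k` contains all
  conjugates of `E` every orbit is a point, `k·φ(E) = k`, and `V_Φ` is literally the printed `⊕_{φ∈Φ} k_φ`.)
* §4 **«if» for every subfield `k ⊇ E*` of `ℂ`** (`exists_module_trace_eq`): base change `k ⊗_{E*} V_Φ` of the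
  module over the number field `E*` (`baseChangeAct`, Mathlib `LinearMap.trace_baseChange`); hence
  **PROPOSITION 1.21** `exists_module_trace_eq_iff` and **COROLLARY 1.22** in the trace form (5):
  `isLeast_reflexFieldOn` — `E*` is the least subfield of `ℂ` over which such a module exists; for number fields
  the same with `traceField` (`exists_module_trace_eq_iff_traceField_le`, `isLeast_traceField`).
* §5 **uniqueness, for a CM FIELD `E = K`** and any field `k` of characteristic `0` (`exists_equiv_of_trace_eq`):
  two finite-dimensional `k`-spaces with `k`-linear `K`-actions and equal traces are `K ⊗ k`-isomorphic.  Proof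
  (a shortcut replacing the printed passage to `Ω`): with `θ` a primitive element of `K/ℚ`, both are
  `k[X]`-modules through `T = ρ(θ)`, semisimple since `T` is killed by the separable minimal polynomial of `θ`
  (Mathlib `Module.End.isSemisimple_of_squarefree_aeval_eq_zero`); semisimple modules with equal traces are
  isomorphic — Bourbaki, *Algèbre* VIII §20 n°6 Cor. a) of Prop. 6, the tree's
  `RepresentationTheory.Semisimple.Module.nonempty_linearEquiv_of_trace_smul_eq` —, and a `k[T]`-isomorphism
  commutes with `K = ℚ[θ]`.
* §6 Validation on `E = ℚ(i)`, `Φ = {φ}`: the module exists over `k = φ(ℚ(i)) = E*` and not over `k = ℚ`.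

NOT HERE: the uniqueness clause for a CM ALGEBRA that is not a field (it reduces to §5 factor by factor through
the idempotents of `E ≅ ∏ Kᵢ`); Cor. 1.22 in the base-change form (6) `V ⊗_{E*} ℚ̄ ≃ ⊕_{φ∈Φ} ℚ̄_φ`; the reflex norm
`N_{k,Φ}(a) = det_E(a|V_Φ)` of §1 Prop. 1.23 / 1.24 for CM algebras (for FIELDS the tree has `ReflexNorm`,
`CMTori.reflexNormCochar`).

## References
* [MilneCM2006] J. S. Milne, *Complex Multiplication* (course notes; version July 14, 2020), Ch. I §1 «The reflex
  norm»: the paragraph before Prop. 1.21, Proposition 1.21 with proof (p. 15), Corollary 1.22 (pp. 15–16).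
* [BourbakiAlgebreVIII2012] N. Bourbaki, *Algèbre, Ch. VIII* (2ᵉ éd. 2012), §20 n°6, Cor. a) de la Prop. 6
  (semisimple modules in characteristic `0` are determined by their traces; used through the tree).
* [GaoUllmo2025] Z. Gao, E. Ullmo, J. Inst. Math. Jussieu 25 (2025), §2.1 (CM pairs `(E, Φ)`; the carrier).

## Provenance

Lane `lit-hodgefound` (Hodge path, Track 2, Layer A3), prover seat `lit-hodgefound-p27` (generation 3), self-proposed
row «A3.3.1⁺⁺/A3.3.2⁺⁺ (module level) — Milne Prop. 1.21 + Cor. 1.22» (lane INBOX 2026-08-21T07:47Z); sequel to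
the seat's `CMAlgebraReflexField` (Prop. 1.16 – 1.18).
-/

set_option autoImplicit false

noncomputable section

open scoped Pointwise IntermediateField Polynomial
open Polynomial (aeval aeval_eq_sum_range aeval_map_algebraMap aeval_algHom_apply)

namespace Literature.NumberTheory.ComplexMultiplication

open Literature.AlgebraicGeometry.GaoUllmo2025
open Literature.AlgebraicGeometry.Motives (CMType)
open Module

/-! ## §0 Linear algebra: the trace of a block-diagonal endomorphism of `Π i, M i` -/

section PiTrace

variable {R : Type} [CommRing R] {ι : Type} {M : ι → Type} [∀ i, AddCommGroup (M i)] [∀ i, Module R (M i)]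

/-- The block-diagonal endomorphism `(vᵢ)ᵢ ↦ (fᵢ vᵢ)ᵢ` of `Π i, M i` defined by a family of endomorphisms
`fᵢ ∈ End(Mᵢ)`, as a ring homomorphism `Π i, End_R(M i) → End_R(Π i, M i)` (the action of `E` on a direct sum
`⊕ m_φ k_φ` in the printed proof is of this shape). [cite: MilneCM2006, Ch. I §1 Prop. 1.21 (proof)] -/
def piEnd : (∀ i, Module.End R (M i)) →+* Module.End R (∀ i, M i) where
  toFun f :=
    { toFun := fun v i => f i (v i)
      map_add' := fun v w => funext fun i => map_add (f i) (v i) (w i)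
      map_smul' := fun c v => funext fun i => map_smul (f i) c (v i) }
  map_one' := LinearMap.ext fun _ => funext fun _ => rfl
  map_mul' _ _ := LinearMap.ext fun _ => funext fun _ => rfl
  map_zero' := LinearMap.ext fun _ => funext fun _ => rfl
  map_add' _ _ := LinearMap.ext fun _ => funext fun _ => rfl

/-- `(⊕ᵢ fᵢ)(v)ᵢ = fᵢ(vᵢ)`. [cite: MilneCM2006, Ch. I §1 Prop. 1.21 (proof)] -/
@[simp] theorem piEnd_apply (f : ∀ i, Module.End R (M i)) (v : ∀ i, M i) (i : ι) :
    piEnd f v i = f i (v i) := rfl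

/-- `Tr(⊕ᵢ fᵢ | ⊕ᵢ Mᵢ) = Σᵢ Tr(fᵢ | Mᵢ)` for finitely many finite free modules (the trace of `a` on
`⊕_φ m_φ k_φ` is `Σ_φ m_φ φ(a)`, as used in the printed proof). [cite: MilneCM2006, Ch. I §1 Prop. 1.21 (proof)] -/
theorem trace_piEnd [Fintype ι] [∀ i, Module.Free R (M i)] [∀ i, Module.Finite R (M i)]
    (f : ∀ i, Module.End R (M i)) :
    LinearMap.trace R (∀ i, M i) (piEnd f) = ∑ i, LinearMap.trace R (M i) (f i) := by
  classical
  let b : ∀ i, Basis (Free.ChooseBasisIndex R (M i)) R (M i) := fun i => Free.chooseBasis R (M i)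
  rw [LinearMap.trace_eq_matrix_trace R (Pi.basis b)]
  simp only [Matrix.trace, Matrix.diag_apply, LinearMap.toMatrix_apply, Pi.basis_apply, Pi.basis_repr,
    piEnd_apply, Pi.single_eq_same]
  rw [Fintype.sum_sigma]
  refine Finset.sum_congr rfl fun i _ => ?_
  rw [LinearMap.trace_eq_matrix_trace R (b i)]
  simp only [Matrix.trace, Matrix.diag_apply, LinearMap.toMatrix_apply]

end PiTrace

/-! ## §1 The fields `k·φ(E)` and the `k`-conjugates of an embedding -/

section OrbitField

variable {E : Type} [CommRing E] [Algebra ℚ E] (k : IntermediateField ℚ ℂ)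

/-- `k·φ(E) ⊂ ℂ`: the subfield of `ℂ` generated over `k` by `φ(E)` (the field `k_φ` of the printed proof when `k`
contains all conjugates of `E`; in general a finite extension of `k`). [cite: MilneCM2006, Ch. I §1 Prop. 1.21 (proof)] -/
def orbitField (φ : Emb E) : IntermediateField k ℂ :=
  IntermediateField.adjoin k (Set.range φ)

/-- `φ(a) ∈ k·φ(E)`. [cite: MilneCM2006, Ch. I §1 Prop. 1.21 (proof)] -/
theorem apply_mem_orbitField (φ : Emb E) (a : E) : φ a ∈ orbitField k φ :=
  IntermediateField.subset_adjoin k _ ⟨a, rfl⟩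

/-- `k ⊆ k·φ(E)`. [cite: MilneCM2006, Ch. I §1 Prop. 1.21 (proof)] -/
theorem coe_mem_orbitField (φ : Emb E) (c : k) : (c : ℂ) ∈ orbitField k φ :=
  (orbitField k φ).algebraMap_mem c

/-- `φ` with values in `k·φ(E)`, a `ℚ`-algebra map `E → k·φ(E)`. [cite: MilneCM2006, Ch. I §1 Prop. 1.21 (proof)] -/
def toOrbitField (φ : Emb E) : E →ₐ[ℚ] orbitField k φ where
  toFun a := ⟨φ a, apply_mem_orbitField k φ a⟩
  map_one' := Subtype.ext (map_one φ)
  map_mul' a b := Subtype.ext (map_mul φ a b)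
  map_zero' := Subtype.ext (map_zero φ)
  map_add' a b := Subtype.ext (map_add φ a b)
  commutes' q := Subtype.ext (by
    change φ (algebraMap ℚ E q) = ((algebraMap ℚ (orbitField k φ) q : orbitField k φ) : ℂ)
    rw [φ.commutes]
    exact IsScalarTower.algebraMap_apply ℚ (orbitField k φ) ℂ q)

/-- `toOrbitField k φ a = φ a` in `ℂ`. [cite: MilneCM2006, Ch. I §1 Prop. 1.21 (proof)] -/
@[simp] theorem coe_toOrbitField (φ : Emb E) (a : E) : (toOrbitField k φ a : ℂ) = φ a := rfl

/-- `E` acts `k`-linearly on `k·φ(E)` through `φ` by multiplication: «`e ∈ E` acts as `φ(e)`» — the module `k_φ`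
of the printed proof. [cite: MilneCM2006, Ch. I §1 Prop. 1.21 (proof)] -/
def orbitFieldAct (φ : Emb E) : E →+* Module.End k (orbitField k φ) where
  toFun a := LinearMap.mulLeft k (toOrbitField k φ a)
  map_one' := by ext x; simp
  map_mul' a b := by ext x; simp
  map_zero' := by ext x; simp
  map_add' a b := by ext x; simp [add_mul]

/-- `a · x = φ(a) x`. [cite: MilneCM2006, Ch. I §1 Prop. 1.21 (proof)] -/
@[simp] theorem orbitFieldAct_apply (φ : Emb E) (a : E) (x : orbitField k φ) :
    orbitFieldAct k φ a x = toOrbitField k φ a * x := rfl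

/-- The trace of `a` acting on `k·φ(E)` is the field trace `Tr_{kφ(E)/k}(φ(a))`.
[cite: MilneCM2006, Ch. I §1 Prop. 1.21 (proof)] -/
theorem trace_orbitFieldAct (φ : Emb E) (a : E) :
    LinearMap.trace k (orbitField k φ) (orbitFieldAct k φ a) =
      Algebra.trace k (orbitField k φ) (toOrbitField k φ a) := rfl

/-- `k·φ(E)` is a finite extension of `k` when `E` is finite over `ℚ` (it is generated by the algebraic numbers
`φ(bᵢ)`, `(bᵢ)` a `ℚ`-basis of `E`). [cite: MilneCM2006, Ch. I §1 Prop. 1.21 (proof)] -/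
instance finiteDimensional_orbitField [Module.Finite ℚ E] (φ : Emb E) :
    FiniteDimensional k (orbitField k φ) := by
  let b := Module.finBasis ℚ E
  have h : orbitField k φ = IntermediateField.adjoin k (Set.range fun i => φ (b i)) := by
    apply le_antisymm
    · rw [orbitField, IntermediateField.adjoin_le_iff]
      rintro _ ⟨a, rfl⟩
      rw [← b.linearCombination_repr a, Finsupp.linearCombination_apply, map_finsuppSum]
      refine sum_mem fun i _ => ?_
      dsimp only
      rw [map_smul, Algebra.smul_def, IsScalarTower.algebraMap_apply ℚ k ℂ]
      exact mul_mem ((IntermediateField.adjoin k _).algebraMap_mem _)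
        (IntermediateField.subset_adjoin k _ ⟨i, rfl⟩)
    · rw [IntermediateField.adjoin_le_iff]
      rintro _ ⟨i, rfl⟩
      exact apply_mem_orbitField k φ (b i)
  rw [h]
  haveI : Finite (Set.range fun i => φ (b i)) := (Set.finite_range _).to_subtype
  exact IntermediateField.finiteDimensional_adjoin fun z hz => by
    obtain ⟨i, rfl⟩ := hz
    exact ((Algebra.IsIntegral.isIntegral (R := ℚ) (b i)).map φ).tower_top

/-- `k·φ(E)` is a free `k`-module (a vector space; recorded to keep instance search short). [folklore] -/
instance free_orbitField (φ : Emb E) : Module.Free k (orbitField k φ) := Module.Free.of_divisionRing _ _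

/-- The embedding `σ ∘ φ : E → ℂ` obtained from a `k`-embedding `σ : k·φ(E) → ℂ`.
[cite: MilneCM2006, Ch. I §1 Prop. 1.21 (proof)] -/
def embOfAlgHom (φ : Emb E) (σ : orbitField k φ →ₐ[k] ℂ) : Emb E :=
  (σ.restrictScalars ℚ).comp (toOrbitField k φ)

/-- `(σ ∘ φ)(a) = σ(φ(a))`. [cite: MilneCM2006, Ch. I §1 Prop. 1.21 (proof)] -/
@[simp] theorem embOfAlgHom_apply (φ : Emb E) (σ : orbitField k φ →ₐ[k] ℂ) (a : E) :
    embOfAlgHom k φ σ a = σ (toOrbitField k φ a) := rfl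

/-- `σ ↦ σ ∘ φ` is injective: a `k`-embedding of `k·φ(E)` is determined on the generators `φ(E)`.
[cite: MilneCM2006, Ch. I §1 Prop. 1.21 (proof)] -/
theorem embOfAlgHom_injective (φ : Emb E) : Function.Injective (embOfAlgHom k φ) := by
  intro σ₁ σ₂ h
  refine IntermediateField.algHom_ext_of_eq_adjoin k (S := orbitField k φ) (s := Set.range φ) rfl fun x hx => ?_
  obtain ⟨a, rfl⟩ := hx
  exact DFunLike.congr_fun h a

/-- The inclusion `k·φ(E) ⊂ ℂ` gives back `φ`. [cite: MilneCM2006, Ch. I §1 Prop. 1.21 (proof)] -/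
theorem embOfAlgHom_val (φ : Emb E) : embOfAlgHom k φ (orbitField k φ).val = φ :=
  AlgHom.ext fun _ => rfl

variable [Module.Finite ℚ E]

/-- **The `k`-conjugates of `φ`**: the embeddings `σ ∘ φ`, `σ` running over the `k`-embeddings `k·φ(E) → ℂ`
(for `k` finite over `ℚ` this is the `Aut(ℂ/k)`-orbit of `φ`, `coe_conjugatesOver`).
[cite: MilneCM2006, Ch. I §1 Prop. 1.21 (proof)] -/
def conjugatesOver (φ : Emb E) : Finset (Emb E) :=
  open scoped Classical in Finset.univ.image (embOfAlgHom k φ)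

/-- `φ` is one of its `k`-conjugates. [cite: MilneCM2006, Ch. I §1 Prop. 1.21 (proof)] -/
theorem self_mem_conjugatesOver (φ : Emb E) : φ ∈ conjugatesOver k φ := by
  classical
  exact Finset.mem_image.2 ⟨(orbitField k φ).val, Finset.mem_univ _, embOfAlgHom_val k φ⟩

/-- A sum over the `k`-conjugates of `φ` is a sum over the `k`-embeddings of `k·φ(E)`.
[cite: MilneCM2006, Ch. I §1 Prop. 1.21 (proof)] -/
theorem sum_conjugatesOver {β : Type} [AddCommMonoid β] (φ : Emb E) (f : Emb E → β) :
    ∑ ψ ∈ conjugatesOver k φ, f ψ = ∑ σ : orbitField k φ →ₐ[k] ℂ, f (embOfAlgHom k φ σ) := by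
  classical
  exact Finset.sum_image fun _ _ _ _ h => embOfAlgHom_injective k φ h

/-- The number of `k`-conjugates of `φ` is `[k·φ(E) : k]`. [cite: MilneCM2006, Ch. I §1 Prop. 1.21 (proof)] -/
theorem card_conjugatesOver (φ : Emb E) : (conjugatesOver k φ).card = finrank k (orbitField k φ) := by
  classical
  rw [conjugatesOver, Finset.card_image_of_injective _ (embOfAlgHom_injective k φ), Finset.card_univ,
    AlgHom.card]

/-- **`Tr_k(a | k·φ(E)) = Σ_ψ ψ(a)`, `ψ` over the `k`-conjugates of `φ`** (the field trace is the sum over the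
`k`-embeddings into `ℂ`, Mathlib `trace_eq_sum_embeddings`). [cite: MilneCM2006, Ch. I §1 Prop. 1.21 (proof)] -/
theorem algebraMap_trace_orbitFieldAct (φ : Emb E) (a : E) :
    algebraMap k ℂ (LinearMap.trace k (orbitField k φ) (orbitFieldAct k φ a)) = ∑ ψ ∈ conjugatesOver k φ, ψ a := by
  rw [trace_orbitFieldAct, trace_eq_sum_embeddings ℂ, sum_conjugatesOver]
  rfl

/-! ### The `k`-conjugates and the `Aut(ℂ/k)`-orbit -/

/-- Every `Aut(ℂ/k)`-translate `τ ∘ φ` is a `k`-conjugate of `φ` (restrict `τ` to `k·φ(E)`).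
[cite: MilneCM2006, Ch. I §1 Prop. 1.21 (proof)] -/
theorem mem_conjugatesOver_of_mem_orbit {φ ψ : Emb E} (h : ψ ∈ MulAction.orbit k.fixingSubgroup φ) :
    ψ ∈ conjugatesOver k φ := by
  classical
  obtain ⟨g, rfl⟩ := h
  have hg : ∀ x ∈ k, (g : ℂ ≃ₐ[ℚ] ℂ) x = x := (IntermediateField.mem_fixingSubgroup_iff _ _).1 g.2
  let σ : orbitField k φ →ₐ[k] ℂ :=
    { toFun := fun x => (g : ℂ ≃ₐ[ℚ] ℂ) x
      map_one' := by simp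
      map_mul' := fun x y => by simp
      map_zero' := by simp
      map_add' := fun x y => by simp
      commutes' := fun c => hg c c.2 }
  refine Finset.mem_image.2 ⟨σ, Finset.mem_univ _, ?_⟩
  ext a
  rfl

/-- For `k` finite over `ℚ`, every `k`-conjugate `σ ∘ φ` is an `Aut(ℂ/k)`-translate of `φ`: `σ` extends to an
automorphism of `ℂ` fixing `k` (the tree's `exists_ringEquiv_apply_eq_algHom`).
[cite: MilneCM2006, Ch. I §1 Prop. 1.21 (proof)] -/
theorem mem_orbit_of_mem_conjugatesOver [FiniteDimensional ℚ k] {φ ψ : Emb E} (h : ψ ∈ conjugatesOver k φ) :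
    ψ ∈ MulAction.orbit k.fixingSubgroup φ := by
  classical
  obtain ⟨σ, -, rfl⟩ := Finset.mem_image.1 h
  -- extend `σ` to an automorphism of `ℂ`
  let C : IntermediateField ℚ ℂ := IntermediateField.restrictScalars ℚ (orbitField k φ)
  haveI : FiniteDimensional ℚ C := by
    change FiniteDimensional ℚ (orbitField k φ)
    exact Module.Finite.trans k (orbitField k φ)
  let φ' : C.toSubalgebra →ₐ[ℚ] ℂ :=
    { toFun := fun z => σ ⟨z.1, z.2⟩
      map_one' := map_one σ
      map_mul' := fun z w => by rw [← map_mul]; rfl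
      map_zero' := map_zero σ
      map_add' := fun z w => by rw [← map_add]; rfl
      commutes' := fun q => by
        have hq := σ.commutes (algebraMap ℚ k q)
        rw [IsScalarTower.algebraMap_apply ℚ k ℂ q, ← hq]
        rfl }
  obtain ⟨τ, hτ⟩ := exists_ringEquiv_apply_eq_algHom C φ'
  let τ' : ℂ ≃ₐ[ℚ] ℂ := AlgEquiv.ofRingEquiv (f := τ) fun q => by simp
  have hτ' : τ' ∈ k.fixingSubgroup := by
    rw [IntermediateField.mem_fixingSubgroup_iff]
    intro y hy
    change τ y = y
    rw [hτ y (coe_mem_orbitField k φ ⟨y, hy⟩)]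
    exact σ.commutes ⟨y, hy⟩
  refine ⟨⟨τ', hτ'⟩, AlgHom.ext fun a => ?_⟩
  change τ (φ a) = σ (toOrbitField k φ a)
  rw [hτ (φ a) (apply_mem_orbitField k φ a)]
  rfl

/-- **For `k` finite over `ℚ` the `k`-conjugates of `φ` form its `Aut(ℂ/k)`-orbit.**
[cite: MilneCM2006, Ch. I §1 Prop. 1.21 (proof)] -/
theorem coe_conjugatesOver [FiniteDimensional ℚ k] (φ : Emb E) :
    (conjugatesOver k φ : Set (Emb E)) = MulAction.orbit k.fixingSubgroup φ :=
  Set.ext fun _ => ⟨mem_orbit_of_mem_conjugatesOver k, mem_conjugatesOver_of_mem_orbit k⟩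

end OrbitField

/-! ## §2 PROPOSITION 1.21, «only if»: the traces lie in `k`, so `k ⊇ E*` -/

section OnlyIf

variable {E : Type} [CommRing E] [Algebra ℚ E] (k : IntermediateField ℚ ℂ)

/-- **PROPOSITION 1.21, «only if»** («If `a` acts `k`-linearly on `V`, then `Tr_k(a|V) ∈ k`, and so, if there
exists a `k`-linear action of `E` satisfying (5) on a `k`-vector space `V`, then certainly `k ⊇ E*`»): if some
`k`-vector space `V` with a `k`-linear action `ρ` of `E` has `Tr_k(a|V) = Σ_{φ∈Φ} φ(a)` for all `a ∈ E`, then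
`E* ≤ k`. [cite: MilneCM2006, Ch. I §1 Prop. 1.21] -/
theorem reflexFieldOn_le_of_trace_eq (Φ : CMTypeOn E) {V : Type} [AddCommGroup V] [Module k V]
    (ρ : E →+* Module.End k V) (h : ∀ a : E, algebraMap k ℂ (LinearMap.trace k V (ρ a)) = cmTraceOn Φ a) :
    reflexFieldOn Φ ≤ k := by
  rw [reflexFieldOn_le_iff]
  intro a
  rw [← h a]
  exact SetLike.coe_mem _

end OnlyIf

/-! ## §3 The module `V_Φ = ⊕_{O ∈ Φ/Aut(ℂ/k)} k·φ_O(E)` and its traces -/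

section Model

variable {E : Type} [CommRing E] [Algebra ℚ E] [Module.Finite ℚ E] (Φ : CMTypeOn E) (k : IntermediateField ℚ ℂ)

/-- If `k ⊇ E*`, the type `Φ` is stable under `Aut(ℂ/k)` (Prop. 1.16: an automorphism fixing `E*` permutes
`Φ`) — «Because `Φ` is stable under `Γ`». [cite: MilneCM2006, Ch. I §1 Prop. 1.21 (proof) and Prop. 1.16] -/
theorem smul_mem_of_reflexFieldOn_le (hk : reflexFieldOn Φ ≤ k) (g : k.fixingSubgroup) {φ : Emb E}
    (hφ : φ ∈ Φ.Φ) : g • φ ∈ Φ.Φ := by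
  have hfix : ∀ x ∈ reflexFieldOn Φ, (g : ℂ ≃ₐ[ℚ] ℂ) x = x := fun x hx =>
    (IntermediateField.mem_fixingSubgroup_iff _ _).1 g.2 x (hk hx)
  have hΦ := (forall_mem_reflexFieldOn_apply_eq_iff Φ (g : ℂ ≃ₐ[ℚ] ℂ)).1 hfix
  rw [← Finset.mem_coe, ← hΦ]
  exact Set.smul_mem_smul_set hφ

/-- If `k ⊇ E*`, `Φ` is a union of `Aut(ℂ/k)`-orbits. [cite: MilneCM2006, Ch. I §1 Prop. 1.21 (proof)] -/
theorem mem_of_mem_orbit (hk : reflexFieldOn Φ ≤ k) {φ ψ : Emb E} (hφ : φ ∈ Φ.Φ)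
    (hψ : ψ ∈ MulAction.orbit k.fixingSubgroup φ) : ψ ∈ Φ.Φ := by
  obtain ⟨g, rfl⟩ := hψ
  exact smul_mem_of_reflexFieldOn_le Φ k hk g hφ

/-- A representative of the `Aut(ℂ/k)`-orbit of `φ` (a choice). [cite: MilneCM2006, Ch. I §1 Prop. 1.21 (proof)] -/
def orbitRep (φ : Emb E) : Emb E :=
  (Quotient.mk (MulAction.orbitRel k.fixingSubgroup (Emb E)) φ).out

/-- The representative lies in the orbit. [cite: MilneCM2006, Ch. I §1 Prop. 1.21 (proof)] -/
theorem orbitRep_mem_orbit (φ : Emb E) : orbitRep k φ ∈ MulAction.orbit k.fixingSubgroup φ :=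
  MulAction.orbitRel_apply.1 (Quotient.mk_out (s := MulAction.orbitRel k.fixingSubgroup (Emb E)) φ)

/-- Two embeddings have the same representative iff they are in the same orbit.
[cite: MilneCM2006, Ch. I §1 Prop. 1.21 (proof)] -/
theorem orbitRep_eq_orbitRep_iff (φ ψ : Emb E) :
    orbitRep k ψ = orbitRep k φ ↔ ψ ∈ MulAction.orbit k.fixingSubgroup φ := by
  constructor
  · intro h
    have h1 : MulAction.orbit k.fixingSubgroup (orbitRep k ψ) = MulAction.orbit k.fixingSubgroup ψ :=
      MulAction.orbit_eq_iff.2 (orbitRep_mem_orbit k ψ)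
    have h2 : MulAction.orbit k.fixingSubgroup (orbitRep k φ) = MulAction.orbit k.fixingSubgroup φ :=
      MulAction.orbit_eq_iff.2 (orbitRep_mem_orbit k φ)
    rw [← MulAction.orbit_eq_iff, ← h1, h, h2]
  · intro h
    unfold orbitRep
    rw [Quotient.sound (MulAction.orbitRel_apply.2 h)]

/-- The chosen representatives of the orbits meeting `Φ` (= the orbits contained in `Φ` when `k ⊇ E*`).
[cite: MilneCM2006, Ch. I §1 Prop. 1.21 (proof)] -/
def orbitReps : Finset (Emb E) := open scoped Classical in Φ.Φ.image (orbitRep k)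

open scoped Classical in
/-- When `k ⊇ E*`, the `k`-conjugates of a representative `r` are exactly the members of `Φ` represented by `r`
(so `Φ = ⊔_r conjugatesOver k r`). [cite: MilneCM2006, Ch. I §1 Prop. 1.21 (proof)] -/
theorem conjugatesOver_eq_filter [FiniteDimensional ℚ k] (hk : reflexFieldOn Φ ≤ k) {r : Emb E}
    (hr : r ∈ orbitReps Φ k) : conjugatesOver k r = Φ.Φ.filter (fun ψ => orbitRep k ψ = r) := by
  classical
  obtain ⟨φ₀, hφ₀, rfl⟩ := Finset.mem_image.1 hr
  have horb : MulAction.orbit k.fixingSubgroup (orbitRep k φ₀) = MulAction.orbit k.fixingSubgroup φ₀ :=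
    MulAction.orbit_eq_iff.2 (orbitRep_mem_orbit k φ₀)
  ext ψ
  rw [← Finset.mem_coe, coe_conjugatesOver, horb, Finset.mem_filter, orbitRep_eq_orbitRep_iff]
  exact ⟨fun h => ⟨mem_of_mem_orbit Φ k hk hφ₀ h, h⟩, fun h => h.2⟩

/-- **The module `V_Φ` over `k`**: `⊕_O k·φ_O(E)` over the `Aut(ℂ/k)`-orbits `O` meeting `Φ`, `φ_O` the chosen
representative — the descended form of `⊕_{φ∈Φ} k_φ` in the printed proof (for `k` containing all conjugates of
`E` every orbit is a point and this is literally `⊕_{φ∈Φ} k_φ`).  A model: Prop. 1.21 asserts existence and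
uniqueness up to isomorphism only. [cite: MilneCM2006, Ch. I §1 Prop. 1.21 (proof)] -/
abbrev traceModule : Type := ∀ r : ↥(orbitReps Φ k), ↥(orbitField k (r : Emb E))

/-- The `k`-linear action of `E` on `V_Φ`: `a · (x_O)_O = (φ_O(a) x_O)_O`. [cite: MilneCM2006, Ch. I §1 Prop. 1.21 (proof)] -/
def traceModuleAct : E →+* Module.End k (traceModule Φ k) :=
  (piEnd (R := k) (M := fun r : ↥(orbitReps Φ k) => ↥(orbitField k (r : Emb E)))).comp
    (RingHom.pi fun r : ↥(orbitReps Φ k) => orbitFieldAct k (r : Emb E))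

/-- `(a · x)_O = φ_O(a) x_O`. [cite: MilneCM2006, Ch. I §1 Prop. 1.21 (proof)] -/
@[simp] theorem traceModuleAct_apply (a : E) (x : traceModule Φ k) (r : ↥(orbitReps Φ k)) :
    traceModuleAct Φ k a x r = toOrbitField k (r : Emb E) a * x r := rfl

/-- `Tr_k(a | V_Φ) = Σ_O Σ_{ψ ~_k φ_O} ψ(a)` (block-diagonal trace, then the field traces).
[cite: MilneCM2006, Ch. I §1 Prop. 1.21 (proof)] -/
theorem algebraMap_trace_traceModuleAct_eq_sum (a : E) :
    algebraMap k ℂ (LinearMap.trace k (traceModule Φ k) (traceModuleAct Φ k a)) =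
      ∑ r ∈ orbitReps Φ k, ∑ ψ ∈ conjugatesOver k r, ψ a := by
  change algebraMap k ℂ (LinearMap.trace k _
    (piEnd fun r : ↥(orbitReps Φ k) => orbitFieldAct k (r : Emb E) a)) = _
  rw [trace_piEnd, map_sum,
    ← Finset.sum_coe_sort (orbitReps Φ k) (fun r => ∑ ψ ∈ conjugatesOver k r, ψ a)]
  exact Finset.sum_congr rfl fun r _ => algebraMap_trace_orbitFieldAct k (r : Emb E) a

/-- **PROPOSITION 1.21, the trace identity (5) for `V_Φ`**: if `k ⊇ E*` (and `k` is a number field), then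
`Tr_k(a | V_Φ) = Σ_{φ∈Φ} φ(a)` for all `a ∈ E`. [cite: MilneCM2006, Ch. I §1 Prop. 1.21] -/
theorem algebraMap_trace_traceModuleAct [FiniteDimensional ℚ k] (hk : reflexFieldOn Φ ≤ k) (a : E) :
    algebraMap k ℂ (LinearMap.trace k (traceModule Φ k) (traceModuleAct Φ k a)) = cmTraceOn Φ a := by
  classical
  rw [algebraMap_trace_traceModuleAct_eq_sum, cmTraceOn_apply,
    ← Finset.sum_fiberwise_of_maps_to (s := Φ.Φ) (t := orbitReps Φ k) (g := orbitRep k)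
      (fun φ hφ => Finset.mem_image_of_mem _ hφ) (fun φ : Emb E => φ a)]
  refine Finset.sum_congr rfl fun r hr => ?_
  rw [conjugatesOver_eq_filter Φ k hk hr]

/-- `dim_k V_Φ = |Φ|` when `k ⊇ E*`. [cite: MilneCM2006, Ch. I §1 Prop. 1.21 (proof)] -/
theorem finrank_traceModule [FiniteDimensional ℚ k] (hk : reflexFieldOn Φ ≤ k) :
    finrank k (traceModule Φ k) = Φ.Φ.card := by
  classical
  rw [Module.finrank_pi_fintype, Finset.sum_coe_sort (orbitReps Φ k) (fun r => finrank k (orbitField k r)),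
    Finset.card_eq_sum_card_fiberwise (f := orbitRep k) (s := Φ.Φ) (t := orbitReps Φ k)
      (fun φ hφ => Finset.mem_image_of_mem _ hφ)]
  refine Finset.sum_congr rfl fun r hr => ?_
  rw [← card_conjugatesOver, conjugatesOver_eq_filter Φ k hk hr]

end Model

/-! ## §4 PROPOSITION 1.21 (existence iff `k ⊇ E*`) and COROLLARY 1.22 -/

section BaseChange

open scoped TensorProduct

variable {E : Type} [Ring E] {k₀ : Type} [Field k₀] (A : Type) [CommRing A] [Algebra k₀ A]
  {V₀ : Type} [AddCommGroup V₀] [Module k₀ V₀]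

/-- Base change `A ⊗_{k₀} V₀` of a `k₀`-linear action of `E` along `k₀ → A` (used to pass from the number field
`E*` to an arbitrary field `k ⊇ E*`; the printed proof descends instead from a finite Galois `Ω ⊇ k`).
[cite: MilneCM2006, Ch. I §1 Prop. 1.21 (proof)] -/
def baseChangeAct (ρ₀ : E →+* Module.End k₀ V₀) : E →+* Module.End A (A ⊗[k₀] V₀) where
  toFun a := (ρ₀ a).baseChange A
  map_one' := by rw [map_one, LinearMap.baseChange_one]
  map_mul' a b := by rw [map_mul, LinearMap.baseChange_mul]
  map_zero' := by rw [map_zero, LinearMap.baseChange_zero]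
  map_add' a b := by rw [map_add, LinearMap.baseChange_add]

/-- `ρ_A(a) = ρ₀(a) ⊗ 1`. [cite: MilneCM2006, Ch. I §1 Prop. 1.21 (proof)] -/
@[simp] theorem baseChangeAct_apply (ρ₀ : E →+* Module.End k₀ V₀) (a : E) :
    baseChangeAct A ρ₀ a = (ρ₀ a).baseChange A := rfl

/-- `Tr_A(a | A ⊗ V₀) = Tr_{k₀}(a | V₀)` (Mathlib `LinearMap.trace_baseChange`; «becomes isomorphic … over `Ω`»
compares traces after extension of scalars). [cite: MilneCM2006, Ch. I §1 Prop. 1.21 (proof)] -/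
theorem trace_baseChangeAct [Module.Free k₀ V₀] [Module.Finite k₀ V₀] (ρ₀ : E →+* Module.End k₀ V₀) (a : E) :
    LinearMap.trace A (A ⊗[k₀] V₀) (baseChangeAct A ρ₀ a) = algebraMap k₀ A (LinearMap.trace k₀ V₀ (ρ₀ a)) :=
  LinearMap.trace_baseChange _ _

end BaseChange

section Prop121

open scoped TensorProduct

variable {E : Type} [CommRing E] [Algebra ℚ E] [Module.Finite ℚ E] (Φ : CMTypeOn E) (k : IntermediateField ℚ ℂ)

/-- **PROPOSITION 1.21, «if»**: for every subfield `k ⊂ ℂ` with `k ⊇ E*` there is a finite-dimensional `k`-vector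
space `V` with a `k`-linear action of `E` such that `Tr_k(a|V) = Σ_{φ∈Φ} φ(a)` for all `a ∈ E` — namely
`k ⊗_{E*} V_Φ`, `V_Φ` the module over the number field `E*` of §3. [cite: MilneCM2006, Ch. I §1 Prop. 1.21] -/
theorem exists_module_trace_eq (hk : reflexFieldOn Φ ≤ k) :
    ∃ (V : Type) (_ : AddCommGroup V) (_ : Module k V) (_ : FiniteDimensional k V) (ρ : E →+* Module.End k V),
      ∀ a : E, algebraMap k ℂ (LinearMap.trace k V (ρ a)) = cmTraceOn Φ a := by
  letI : Algebra (reflexFieldOn Φ) k := (IntermediateField.inclusion hk).toRingHom.toAlgebra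
  refine ⟨k ⊗[reflexFieldOn Φ] traceModule Φ (reflexFieldOn Φ), inferInstance, inferInstance, inferInstance,
    baseChangeAct k (traceModuleAct Φ (reflexFieldOn Φ)), fun a => ?_⟩
  rw [trace_baseChangeAct, ← algebraMap_trace_traceModuleAct Φ (reflexFieldOn Φ) le_rfl a]
  rfl

/-- For a number field `k ⊇ E*` the module `V_Φ` of §3 itself will do. [cite: MilneCM2006, Ch. I §1 Prop. 1.21] -/
theorem exists_module_trace_eq_of_finiteDimensional [FiniteDimensional ℚ k] (hk : reflexFieldOn Φ ≤ k) :
    ∃ (V : Type) (_ : AddCommGroup V) (_ : Module k V) (_ : FiniteDimensional k V) (ρ : E →+* Module.End k V),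
      ∀ a : E, algebraMap k ℂ (LinearMap.trace k V (ρ a)) = cmTraceOn Φ a :=
  ⟨traceModule Φ k, inferInstance, inferInstance, inferInstance, traceModuleAct Φ k,
    algebraMap_trace_traceModuleAct Φ k hk⟩

/-- **PROPOSITION 1.21** («Let `(E, Φ)` be a CM-pair, and let `k` be a subfield of `ℚ̄`.  There exists a finitely
generated `E ⊗_ℚ k`-module `V` such that `Tr_k(a|V) = Σ_{φ∈Φ} φ(a)`, all `a ∈ E`, (5) if and only if `k ⊇ E*`»),
for every subfield `k ⊂ ℂ`, an `E ⊗_ℚ k`-module being «a finite-dimensional `k`-vector space `V` together with a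
`k`-linear action of `E`». [cite: MilneCM2006, Ch. I §1 Prop. 1.21] -/
theorem exists_module_trace_eq_iff :
    (∃ (V : Type) (_ : AddCommGroup V) (_ : Module k V) (_ : FiniteDimensional k V) (ρ : E →+* Module.End k V),
      ∀ a : E, algebraMap k ℂ (LinearMap.trace k V (ρ a)) = cmTraceOn Φ a) ↔ reflexFieldOn Φ ≤ k :=
  ⟨fun ⟨_, _, _, _, ρ, h⟩ => reflexFieldOn_le_of_trace_eq k Φ ρ h, exists_module_trace_eq Φ k⟩

/-- **COROLLARY 1.22 (in the trace form (5))**: «The reflex field `E*` is the smallest subfield of `ℚ̄` such that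
there exists an `E ⊗_ℚ E*`-module `V` with» `Tr(a|V) = Σ_{φ∈Φ} φ(a)` («PROOF. Restatement of the proposition»).
[cite: MilneCM2006, Ch. I §1 Cor. 1.22] -/
theorem isLeast_reflexFieldOn :
    IsLeast {k : IntermediateField ℚ ℂ | ∃ (V : Type) (_ : AddCommGroup V) (_ : Module k V)
      (_ : FiniteDimensional k V) (ρ : E →+* Module.End k V),
        ∀ a : E, algebraMap k ℂ (LinearMap.trace k V (ρ a)) = cmTraceOn Φ a} (reflexFieldOn Φ) :=
  ⟨exists_module_trace_eq Φ (reflexFieldOn Φ) le_rfl, fun k ⟨_, _, _, _, ρ, h⟩ => reflexFieldOn_le_of_trace_eq k Φ ρ h⟩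

end Prop121

/-! ### Number fields: the statements with the tree's complex reflex field `traceField` -/

section FieldCase

variable (K : Type) [Field K] [NumberField K] (Φ : CMType K) (k : IntermediateField ℚ ℂ)

/-- Prop. 1.21 for a CM FIELD `K` in the tree's complex vocabulary: a finite-dimensional `k`-space with a
`k`-linear `K`-action and traces `Σ_{φ∈Φ} φ(a)` exists iff `k ⊇ K* = traceField Φ`.
[cite: MilneCM2006, Ch. I §1 Prop. 1.21] -/
theorem exists_module_trace_eq_iff_traceField_le :
    (∃ (V : Type) (_ : AddCommGroup V) (_ : Module k V) (_ : FiniteDimensional k V) (ρ : K →+* Module.End k V),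
      ∀ a : K, algebraMap k ℂ (LinearMap.trace k V (ρ a)) = cmTypeTrace Φ a) ↔ traceField Φ ≤ k := by
  rw [← reflexFieldOn_cmTypeEquivCMTypeOn]
  simp_rw [← cmTraceOn_cmTypeEquivCMTypeOn]
  exact exists_module_trace_eq_iff _ k

/-- Cor. 1.22 for a CM FIELD: `traceField Φ` is the least subfield `k ⊂ ℂ` over which such a module exists.
[cite: MilneCM2006, Ch. I §1 Cor. 1.22] -/
theorem isLeast_traceField :
    IsLeast {k : IntermediateField ℚ ℂ | ∃ (V : Type) (_ : AddCommGroup V) (_ : Module k V)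
      (_ : FiniteDimensional k V) (ρ : K →+* Module.End k V),
        ∀ a : K, algebraMap k ℂ (LinearMap.trace k V (ρ a)) = cmTypeTrace Φ a} (traceField Φ) := by
  rw [← reflexFieldOn_cmTypeEquivCMTypeOn]
  simp_rw [← cmTraceOn_cmTypeEquivCMTypeOn]
  exact isLeast_reflexFieldOn _

end FieldCase

/-! ## §5 PROPOSITION 1.21, uniqueness: `V` is determined by its traces (field case) -/

section Uniqueness

variable {K : Type} [Field K] [NumberField K] {k : Type} [Field k] [CharZero k]
variable {V W : Type} [AddCommGroup V] [Module k V] [FiniteDimensional k V]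
  [AddCommGroup W] [Module k W] [FiniteDimensional k W]

omit [NumberField K] [CharZero k] [FiniteDimensional k V] in
/-- The trace of a polynomial in an endomorphism `T = ρ(θ)` is determined by the traces of the `ρ(θⁱ)`.
[folklore] -/
private theorem trace_aeval_eq_sum (ρ : K →+* Module.End k V) (θ : K) (p : k[X]) :
    LinearMap.trace k V (aeval (ρ θ) p) =
      ∑ i ∈ Finset.range (p.natDegree + 1), p.coeff i * LinearMap.trace k V (ρ (θ ^ i)) := by
  rw [aeval_eq_sum_range, map_sum]
  refine Finset.sum_congr rfl fun i _ => ?_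
  rw [map_smul, smul_eq_mul, map_pow ρ]

/-- **PROPOSITION 1.21, uniqueness** («in which case `V` is uniquely determined up to an
`E ⊗_ℚ k`-isomorphism»), for a number FIELD `E = K` and any field `k` of characteristic `0`: two
finite-dimensional `k`-vector spaces with `k`-linear actions of `K` and the same traces `Tr_k(a|V) = Tr_k(a|W)`,
`a ∈ K`, are isomorphic as `E ⊗_ℚ k`-modules.  Proof: with `θ` a primitive element of `K/ℚ`, `V` and `W` are
`k[X]`-modules through `T = ρ(θ)`, semisimple because `T` is killed by the separable minimal polynomial of `θ`;
semisimple modules with the same traces are isomorphic (Bourbaki, *Algèbre* VIII §20 n°6 Cor. a), the tree's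
`Module.nonempty_linearEquiv_of_trace_smul_eq`); a `k[T]`-isomorphism commutes with `K = ℚ[θ]`.
[cite: MilneCM2006, Ch. I §1 Prop. 1.21] -/
theorem exists_equiv_of_trace_eq (ρV : K →+* Module.End k V) (ρW : K →+* Module.End k W)
    (h : ∀ a : K, LinearMap.trace k V (ρV a) = LinearMap.trace k W (ρW a)) :
    ∃ e : V ≃ₗ[k] W, ∀ (a : K) (v : V), e (ρV a v) = ρW a (e v) := by
  classical
  -- `ℚ`-structures on `V`, `W` through `k`
  letI : Module ℚ V := Module.compHom V (algebraMap ℚ k)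
  letI : Module ℚ W := Module.compHom W (algebraMap ℚ k)
  haveI : IsScalarTower ℚ k V := ⟨fun q c v => by
    change (q • c) • v = algebraMap ℚ k q • (c • v)
    rw [Algebra.smul_def, mul_smul]⟩
  haveI : IsScalarTower ℚ k W := ⟨fun q c v => by
    change (q • c) • v = algebraMap ℚ k q • (c • v)
    rw [Algebra.smul_def, mul_smul]⟩
  let ρV' : K →ₐ[ℚ] Module.End k V := ρV.toRatAlgHom
  let ρW' : K →ₐ[ℚ] Module.End k W := ρW.toRatAlgHom
  -- a primitive element and its separable minimal polynomial
  obtain ⟨θ, hθ⟩ := Field.exists_primitive_element ℚ K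
  have hθi : IsIntegral ℚ θ := Algebra.IsIntegral.isIntegral θ
  set μ : k[X] := (minpoly ℚ θ).map (algebraMap ℚ k) with hμ_def
  have hsep : (minpoly ℚ θ).Separable := Algebra.IsSeparable.isSeparable ℚ θ
  have hμ : Squarefree μ := hsep.map.squarefree
  have hkill : ∀ {U : Type} [AddCommGroup U] [Module k U] [Module ℚ U] [IsScalarTower ℚ k U]
      (ρ' : K →ₐ[ℚ] Module.End k U), aeval (ρ' θ) μ = 0 := by
    intro U _ _ _ _ ρ'
    rw [hμ_def, aeval_map_algebraMap, aeval_algHom_apply, minpoly.aeval, map_zero]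
  have hsV : (ρV θ).IsSemisimple := Module.End.isSemisimple_of_squarefree_aeval_eq_zero hμ (hkill ρV')
  have hsW : (ρW θ).IsSemisimple := Module.End.isSemisimple_of_squarefree_aeval_eq_zero hμ (hkill ρW')
  haveI : IsSemisimpleModule k[X] (AEval' (ρV θ)) := hsV
  haveI : IsSemisimpleModule k[X] (AEval' (ρW θ)) := hsW
  -- the traces of polynomials in `T` agree
  have hconj : ∀ {U : Type} [AddCommGroup U] [Module k U] [FiniteDimensional k U] (T : Module.End k U)
      (p : k[X]), LinearMap.trace k (AEval' T) (DistribSMul.toLinearMap k (AEval' T) p) =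
        LinearMap.trace k U (aeval T p) := by
    intro U _ _ _ T p
    rw [← LinearMap.trace_conj' (aeval T p) (AEval'.of T)]
    rfl
  have htr : ∀ p : k[X], LinearMap.trace k (AEval' (ρV θ)) (DistribSMul.toLinearMap k (AEval' (ρV θ)) p) =
      LinearMap.trace k (AEval' (ρW θ)) (DistribSMul.toLinearMap k (AEval' (ρW θ)) p) := by
    intro p
    rw [hconj, hconj, trace_aeval_eq_sum, trace_aeval_eq_sum]
    exact Finset.sum_congr rfl fun i _ => by rw [h]
  obtain ⟨e⟩ := Literature.RepresentationTheory.Semisimple.Module.nonempty_linearEquiv_of_trace_smul_eq htr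
  -- back to `k`-linear maps `V → W`
  let e' : V ≃ₗ[k] W := ((AEval'.of (ρV θ)).trans (e.restrictScalars k)).trans (AEval'.of (ρW θ)).symm
  have hT : ∀ v : V, e' (ρV θ v) = ρW θ (e' v) := by
    intro v
    change (AEval'.of (ρW θ)).symm (e (AEval'.of (ρV θ) (ρV θ v))) =
      ρW θ ((AEval'.of (ρW θ)).symm (e (AEval'.of (ρV θ) v)))
    rw [← AEval'.X_smul_of, map_smul, AEval'.of_symm_X_smul]
  -- the elements of `K` commuting with `e'` form a `ℚ`-subalgebra containing `θ`, i.e. all of `K = ℚ(θ)`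
  let S : Subalgebra ℚ K :=
    { carrier := {a | ∀ v : V, e' (ρV a v) = ρW a (e' v)}
      mul_mem' := fun {a b} ha hb v => by
        simp only [Set.mem_setOf_eq] at ha hb ⊢
        rw [map_mul, map_mul, Module.End.mul_apply, Module.End.mul_apply, ha, hb]
      one_mem' := fun v => by simp
      add_mem' := fun {a b} ha hb v => by
        simp only [Set.mem_setOf_eq] at ha hb ⊢
        rw [map_add, map_add, LinearMap.add_apply, LinearMap.add_apply, map_add, ha, hb]
      zero_mem' := fun v => by simp
      algebraMap_mem' := fun q v => by
        have hVq : ρV (algebraMap ℚ K q) = algebraMap k (Module.End k V) (algebraMap ℚ k q) := by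
          rw [← IsScalarTower.algebraMap_apply]; exact ρV'.commutes q
        have hWq : ρW (algebraMap ℚ K q) = algebraMap k (Module.End k W) (algebraMap ℚ k q) := by
          rw [← IsScalarTower.algebraMap_apply]; exact ρW'.commutes q
        rw [hVq, hWq, Module.algebraMap_end_apply, Module.algebraMap_end_apply, map_smul] }
  have hS : S = ⊤ := by
    rw [eq_top_iff, ← IntermediateField.top_toSubalgebra, ← hθ,
      IntermediateField.adjoin_simple_toSubalgebra_of_isAlgebraic hθi.isAlgebraic, Algebra.adjoin_le_iff,
      Set.singleton_subset_iff]
    exact hT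
  refine ⟨e', fun a => ?_⟩
  have ha : a ∈ S := by rw [hS]; exact Algebra.mem_top
  exact ha

end Uniqueness

/-! ## §6 Validation: `E = ℚ(i)` -/

section Validation

open CMTypeCount

/-- For `(ℚ(i), {φ})` the reflex field is `φ(ℚ(i)) = ℚ(i) ⊂ ℂ`, over which the module of Prop. 1.21 exists.
[cite: MilneCM2006, Ch. I §1 Prop. 1.21] -/
theorem exists_module_trace_eq_gaussian (φ : GaussianField →+* ℂ) :
    ∃ (V : Type) (_ : AddCommGroup V) (_ : Module φ.toRatAlgHom.fieldRange V)
      (_ : FiniteDimensional φ.toRatAlgHom.fieldRange V) (ρ : GaussianField →+* Module.End φ.toRatAlgHom.fieldRange V),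
      ∀ a, algebraMap φ.toRatAlgHom.fieldRange ℂ (LinearMap.trace _ V (ρ a)) = cmTypeTrace (gaussianCMType φ) a := by
  rw [exists_module_trace_eq_iff_traceField_le, traceField_gaussianCMType]

/-- … but not over `k = ℚ`: `ℚ ⊉ ℚ(i) = E*`. [cite: MilneCM2006, Ch. I §1 Prop. 1.21] -/
theorem not_exists_module_trace_eq_gaussian_bot (φ : GaussianField →+* ℂ) :
    ¬ ∃ (V : Type) (_ : AddCommGroup V) (_ : Module (⊥ : IntermediateField ℚ ℂ) V)
      (_ : FiniteDimensional (⊥ : IntermediateField ℚ ℂ) V)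
      (ρ : GaussianField →+* Module.End (⊥ : IntermediateField ℚ ℂ) V),
      ∀ a, algebraMap (⊥ : IntermediateField ℚ ℂ) ℂ (LinearMap.trace _ V (ρ a)) = cmTypeTrace (gaussianCMType φ) a := by
  rw [exists_module_trace_eq_iff_traceField_le, traceField_gaussianCMType, le_bot_iff]
  intro h
  have h2 : finrank ℚ φ.toRatAlgHom.fieldRange = 2 := by
    rw [← finrank_gaussianField]
    exact (AlgEquiv.ofInjectiveField φ.toRatAlgHom).symm.toLinearEquiv.finrank_eq
  rw [h, IntermediateField.finrank_bot] at h2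
  exact absurd h2 (by norm_num)

end Validation

end Literature.NumberTheory.ComplexMultiplication

end
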